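import Literature.MathematicalPhysics.QuantumFieldTheory.Balaban1983to89.MatrixLogLipschitz
import HarnessLib

/-!
# BalabanUVNodes ∕ node N18 = NE5 — closure-ledger item (iii), comb step M4c, file (6b-alg):
# SECOND-ORDER LIPSCHITZ LETTERS FOR `u ↦ log(1+u) − u` AND `u ↦ eᵘ − 1 − u` IN A BANACH ALGEBRA

(Track A, DAG node N18 = `T4OutputRate.NE5`; cluster K4 «SpineRates», key item K3⁸ `SpineGivenEndpointR13SepCoPHV` (stmt-QuantumFields-27366);
seat pub-ymgap-dag-n18-w3 g5, INTENT-6 = design step M4c of `COMB-STEP-DESIGN.md` ∕ `COMB-CHAIN-INDEX.md`.)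

HONEST FRAMING.  Count-neutral kernel bookkeeping (`--supports stmt-QuantumFields-27366 --as helper`): two folklore series estimates, the
second-order companions of the tree's first-order Lipschitz letters `MatrixLogLipschitz.norm_logOnePlus_sub_logOnePlus_le` ((21) of
[Balaban1985Averaging] is `(1−r)⁻¹`-Lipschitz) and `RungeUnits.norm_exp_sub_exp_le`.  They are the two "pointwise" Lipschitz constants WITH A
SMALLNESS FACTOR `r` that the coarse-Lipschitz bound of the linearisation remainder of the averaged potential (M4c, files (6b), (6c)) needs:
the remainder is second order, so its Lipschitz constant is proportional to the radius.  Nothing of Bałaban's analysis is asserted; NE5 NOT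
printed ∕ NOT proved; N18 NOT discharged; YM mass gap (Clay) NOT proved — R4 closes the conditional finite-𝕋⁴ rung `BalabanLadder.UV` only.

WHAT.
* `norm_pow_succ_sub_pow_succ_le_of_le` — `‖xⁿ⁺¹ − yⁿ⁺¹‖ ≤ (n+1)·rⁿ·‖x − y‖` for `‖x‖, ‖y‖ ≤ r` (telescoping; public twin of the private letter of
  `MatrixLogLipschitz`, radius form — no `NormOneClass` needed).
* ★ `norm_logOnePlus_sub_sub_le` — `‖(log(1+x) − x) − (log(1+y) − y)‖ ≤ r·‖x − y‖∕(1 − r)` for `‖x‖, ‖y‖ ≤ r < 1`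
  (termwise `Σ_{n≥2} (1∕n)‖xⁿ − yⁿ‖ ≤ Σ_{n≥2} rⁿ⁻¹‖x − y‖`); mlog letters ★ `norm_mlog_sub_sub_mlog_sub_le`.
* ★ `norm_exp_sub_sub_exp_sub_le` — `‖(eˣ − 1 − x) − (eʸ − 1 − y)‖ ≤ r·eʳ·‖x − y‖` for `‖x‖, ‖y‖ ≤ r`
  (termwise `Σ_{n≥2} ‖xⁿ − yⁿ‖∕n! ≤ Σ_{m≥0} r^{m+1}∕m!·‖x − y‖`).

0 `def`, 0 `sorry`.  References: T. Bałaban, CMP **98** (1985) 17–51 [Balaban1985Averaging] ((21), (26) pp.21–22: the series logarithm and its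
estimates); CMP **109** (1987) 249–301 [Balaban1987RG1] ((1.13) p.262: the exponential chart `exp iηA`).
-/

noncomputable section

open NormedSpace
open scoped BigOperators Nat

namespace YMDAG.N18.TransportOfRecord

open Literature.Analysis.Complex (logOnePlus logSeriesCoeff summable_logOnePlus logSeriesCoeff_zero)
open Literature.MathematicalPhysics.QuantumFieldTheory.Balaban1983to89 MatrixLog MatrixLogLipschitz

section SecondOrder

variable {𝔄 : Type*} [NormedRing 𝔄] [NormedAlgebra ℂ 𝔄]

omit [NormedAlgebra ℂ 𝔄] in
/-- `‖xⁿ⁺¹ − yⁿ⁺¹‖ ≤ (n + 1)·rⁿ·‖x − y‖` for `‖x‖, ‖y‖ ≤ r` (telescoping `xⁿ⁺² − yⁿ⁺² = x(xⁿ⁺¹ − yⁿ⁺¹) + (x − y)yⁿ⁺¹`, no commutativity;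
radius form of `RungeUnits.norm_pow_succ_sub_pow_succ_le`). [folklore] -/
theorem norm_pow_succ_sub_pow_succ_le_of_le {x y : 𝔄} {r : ℝ} (hx : ‖x‖ ≤ r) (hy : ‖y‖ ≤ r) :
    ∀ n : ℕ, ‖x ^ (n + 1) - y ^ (n + 1)‖ ≤ (n + 1) * r ^ n * ‖x - y‖
  | 0 => by simp
  | n + 1 => by
    have hr : 0 ≤ r := (norm_nonneg x).trans hx
    have ih := norm_pow_succ_sub_pow_succ_le_of_le hx hy n
    have e : x ^ (n + 2) - y ^ (n + 2) = x * (x ^ (n + 1) - y ^ (n + 1)) + (x - y) * y ^ (n + 1) := by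
      simp only [pow_succ']; noncomm_ring
    rw [e]
    calc ‖x * (x ^ (n + 1) - y ^ (n + 1)) + (x - y) * y ^ (n + 1)‖
        ≤ ‖x‖ * ‖x ^ (n + 1) - y ^ (n + 1)‖ + ‖x - y‖ * ‖y ^ (n + 1)‖ :=
          (norm_add_le _ _).trans (add_le_add (norm_mul_le _ _) (norm_mul_le _ _))
      _ ≤ r * ((n + 1) * r ^ n * ‖x - y‖) + ‖x - y‖ * r ^ (n + 1) := by
          refine add_le_add (mul_le_mul hx ih (norm_nonneg _) hr) (mul_le_mul_of_nonneg_left ?_ (norm_nonneg _))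
          exact (norm_pow_le' y (Nat.succ_pos n)).trans (pow_le_pow_left₀ (norm_nonneg y) hy _)
      _ = ((n + 1 : ℕ) + 1) * r ^ (n + 1) * ‖x - y‖ := by push_cast; ring

variable [CompleteSpace 𝔄]

/-- ★ **THE SERIES LOGARITHM MINUS ITS LINEAR PART IS `r∕(1−r)`-LIPSCHITZ ON `‖·‖ ≤ r < 1`**:
`‖(log(1+x) − x) − (log(1+y) − y)‖ ≤ r·‖x − y‖∕(1 − r)` — termwise `Σ_{n≥2} (1∕n)‖xⁿ − yⁿ‖ ≤ Σ_{n≥2} rⁿ⁻¹‖x − y‖`; the second-order companion of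
`MatrixLogLipschitz.norm_logOnePlus_sub_logOnePlus_le` (the Lipschitz constant carries the radius `r`). [cite: Balaban1985Averaging, (21) p.21, (26) p.22] -/
theorem norm_logOnePlus_sub_sub_le {x y : 𝔄} {r : ℝ} (hr : r < 1) (hx : ‖x‖ ≤ r) (hy : ‖y‖ ≤ r) :
    ‖(logOnePlus x - x) - (logOnePlus y - y)‖ ≤ r * ‖x - y‖ / (1 - r) := by
  have hr0 : 0 ≤ r := (norm_nonneg x).trans hx
  have hx1 : ‖x‖ < 1 := hx.trans_lt hr
  have hy1 : ‖y‖ < 1 := hy.trans_lt hr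
  have hsx := summable_logOnePlus hx1
  have hsy := summable_logOnePlus hy1
  set f : ℕ → 𝔄 := fun n => logSeriesCoeff n • x ^ n - logSeriesCoeff n • y ^ n with hf
  have hsub : Summable f := hsx.sub hsy
  have e : logOnePlus x - logOnePlus y = ∑' n : ℕ, f n := by
    rw [hf, hsx.tsum_sub hsy]; rfl
  have h2 : Summable fun n : ℕ => f (n + 2) := (summable_nat_add_iff 2).mpr hsub
  have hsplit : ∑' n : ℕ, f n = f 0 + f 1 + ∑' n : ℕ, f (n + 2) := by
    rw [← hsub.sum_add_tsum_nat_add 2, Finset.sum_range_succ, Finset.sum_range_one]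
  have hf0 : f 0 = 0 := by simp [hf]
  have hf1 : f 1 = x - y := by simp [hf, logSeriesCoeff]
  have ee : (logOnePlus x - x) - (logOnePlus y - y) = ∑' n : ℕ, f (n + 2) := by
    have : (logOnePlus x - x) - (logOnePlus y - y) = (logOnePlus x - logOnePlus y) - (x - y) := by abel
    rw [this, e, hsplit, hf0, hf1, zero_add, add_sub_cancel_left]
  rw [ee]
  have hgeom : HasSum (fun n : ℕ => (r * ‖x - y‖) * r ^ n) (r * ‖x - y‖ / (1 - r)) := by
    rw [div_eq_mul_inv]
    exact (hasSum_geometric_of_lt_one hr0 hr).mul_left (r * ‖x - y‖)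
  refine tsum_of_norm_bounded hgeom fun n => ?_
  show ‖logSeriesCoeff (n + 2) • x ^ (n + 2) - logSeriesCoeff (n + 2) • y ^ (n + 2)‖ ≤ r * ‖x - y‖ * r ^ n
  rw [← smul_sub]
  refine (norm_smul_le _ _).trans ?_
  rw [norm_logSeriesCoeff_succ (n + 1)]
  have h := norm_pow_succ_sub_pow_succ_le_of_le hx hy (n + 1)
  have hn : (0 : ℝ) < (n + 1 : ℕ) + 1 := by positivity
  calc 1 / (((n + 1 : ℕ) : ℝ) + 1) * ‖x ^ (n + 1 + 1) - y ^ (n + 1 + 1)‖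
      ≤ 1 / (((n + 1 : ℕ) : ℝ) + 1) * ((((n + 1 : ℕ) : ℝ) + 1) * r ^ (n + 1) * ‖x - y‖) :=
        mul_le_mul_of_nonneg_left (by exact_mod_cast h) (by positivity)
    _ = r * ‖x - y‖ * r ^ n := by
        rw [one_div, ← mul_assoc, ← mul_assoc, inv_mul_cancel₀ hn.ne', one_mul, pow_succ]; ring

/-- ★ **`log(X) − (X − 1)` IS `r∕(1−r)`-LIPSCHITZ ON `‖X − 1‖ ≤ r < 1`**, written at `X = 1 + Z`:
`‖(log(1+Z) − Z) − (log(1+Z′) − Z′)‖ ≤ r·‖Z − Z′‖∕(1 − r)` (`MatrixLog.mlog` = the series (21)). [cite: Balaban1985Averaging, (21) p.21, (26) p.22] -/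
theorem norm_mlog_sub_sub_mlog_sub_le {Z Z' : 𝔄} {r : ℝ} (hr : r < 1) (hZ : ‖Z‖ ≤ r) (hZ' : ‖Z'‖ ≤ r) :
    ‖(mlog (1 + Z) - Z) - (mlog (1 + Z') - Z')‖ ≤ r * ‖Z - Z'‖ / (1 - r) := by
  rw [mlog_def, mlog_def, add_sub_cancel_left, add_sub_cancel_left]
  exact norm_logOnePlus_sub_sub_le hr hZ hZ'

/-- ★ **`eˣ − 1 − x` IS `r·eʳ`-LIPSCHITZ ON `‖·‖ ≤ r`**: `‖(eˣ − 1 − x) − (eʸ − 1 − y)‖ ≤ r·eʳ·‖x − y‖` — termwise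
`Σ_{n≥2} ‖xⁿ − yⁿ‖∕n! ≤ Σ_{m≥0} r^{m+1}∕m!·‖x − y‖`; the second-order companion of `RungeUnits.norm_exp_sub_exp_le` (the chart `exp iηA` of (1.13)
linearised with a Lipschitz remainder). [cite: Balaban1987RG1, (1.13) p.262] -/
theorem norm_exp_sub_sub_exp_sub_le {x y : 𝔄} {r : ℝ} (hx : ‖x‖ ≤ r) (hy : ‖y‖ ≤ r) :
    ‖(exp x - 1 - x) - (exp y - 1 - y)‖ ≤ r * Real.exp r * ‖x - y‖ := by
  have hr0 : 0 ≤ r := (norm_nonneg x).trans hx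
  set f : ℕ → 𝔄 := fun n => ((n ! : ℂ)⁻¹ • x ^ n - (n ! : ℂ)⁻¹ • y ^ n) with hf
  have hsub : HasSum f (exp x - exp y) := (exp_series_hasSum_exp' (𝕂 := ℂ) x).sub (exp_series_hasSum_exp' (𝕂 := ℂ) y)
  have hs : Summable f := hsub.summable
  have hsplit : ∑' n : ℕ, f n = f 0 + f 1 + ∑' n : ℕ, f (n + 2) := by
    rw [← hs.sum_add_tsum_nat_add 2, Finset.sum_range_succ, Finset.sum_range_one]
  have hf0 : f 0 = 0 := by simp [hf]
  have hf1 : f 1 = x - y := by simp [hf]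
  have ee : (exp x - 1 - x) - (exp y - 1 - y) = ∑' n : ℕ, f (n + 2) := by
    have : (exp x - 1 - x) - (exp y - 1 - y) = (exp x - exp y) - (x - y) := by abel
    rw [this, ← hsub.tsum_eq, hsplit, hf0, hf1, zero_add, add_sub_cancel_left]
  rw [ee]
  have hreal : HasSum (fun n : ℕ => r ^ n / n !) (Real.exp r) := by
    have h := exp_series_hasSum_exp' (𝕂 := ℝ) r
    rw [← Real.exp_eq_exp_ℝ] at h
    simpa [smul_eq_mul, div_eq_inv_mul] using h
  have hdom : HasSum (fun n : ℕ => (r * ‖x - y‖) * (r ^ n / n !)) ((r * ‖x - y‖) * Real.exp r) := hreal.mul_left (r * ‖x - y‖)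
  refine (tsum_of_norm_bounded hdom fun m => ?_).trans_eq (by ring)
  show ‖((((m + 2)! : ℕ) : ℂ))⁻¹ • x ^ (m + 2) - ((((m + 2)! : ℕ) : ℂ))⁻¹ • y ^ (m + 2)‖ ≤ r * ‖x - y‖ * (r ^ m / m !)
  rw [← smul_sub, norm_smul, norm_inv, Complex.norm_natCast]
  have h := norm_pow_succ_sub_pow_succ_le_of_le hx hy (m + 1)
  have hfac2 : (((m + 2)! : ℕ) : ℝ) = ((m : ℝ) + 2) * (((m + 1)! : ℕ) : ℝ) := by
    rw [Nat.factorial_succ (m + 1)]; push_cast; ring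
  have hfac1 : ((m ! : ℕ) : ℝ) ≤ (((m + 1)! : ℕ) : ℝ) := by exact_mod_cast Nat.factorial_le (Nat.le_succ m)
  have hm0 : (0 : ℝ) < ((m ! : ℕ) : ℝ) := by positivity
  have hm1 : (0 : ℝ) < (((m + 1)! : ℕ) : ℝ) := by positivity
  have hm2 : (0 : ℝ) < (m : ℝ) + 2 := by positivity
  calc ((((m + 2)! : ℕ) : ℝ))⁻¹ * ‖x ^ (m + 1 + 1) - y ^ (m + 1 + 1)‖
      ≤ ((((m + 2)! : ℕ) : ℝ))⁻¹ * ((((m + 1 : ℕ) : ℝ) + 1) * r ^ (m + 1) * ‖x - y‖) :=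
        mul_le_mul_of_nonneg_left h (by positivity)
    _ = r ^ (m + 1) * ‖x - y‖ / (((m + 1)! : ℕ) : ℝ) := by
        rw [hfac2]
        have : (((m + 1 : ℕ) : ℝ) + 1) = (m : ℝ) + 2 := by push_cast; ring
        rw [this]
        field_simp
    _ ≤ r ^ (m + 1) * ‖x - y‖ / ((m ! : ℕ) : ℝ) := div_le_div_of_nonneg_left (by positivity) hm0 hfac1
    _ = r * ‖x - y‖ * (r ^ m / m !) := by rw [pow_succ]; ring

end SecondOrder

end YMDAG.N18.TransportOfRecord

end
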